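import Summits.ResolutionOfSingularities.ResolutionOfSingularities.Theorems.HomologicalConductorNoZenoExcCurvesBaseChange
import HarnessLib

/-!
# Crux `NoZenoR` (stmt-ResolutionOfSingularities-19943), slot `stub_L1wCoreF`, (B1) split core, assembly seam (A4):
# the integral exceptional curves after a rational contraction are the images of the non-contracted ones

Route `ResolutionOfSingularities/HomologicalConductor`.  OURS (cell res-hironaka, crux chain W4.4, lead seat
res-L0-w44-lead-1 g8, memo `B1-CENSUS-g8.md` §2 (A4)); nothing here is a statement of the manuscript under review
(Hironaka 2017); AI-written, weaker than expert review.

STEP 3 (4) of the (B1) split core contracts the node curves `F` of the resolution `ψ : W → Spec S′` of the chart germ by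
the named fact `Lipman1969_27_1_reg_rat`, whose OUTPUT is a resolution `g : Y → Spec S′` and an `S′`-morphism
`h : W → Y` with `h⁻¹(h η) = closure {η}` for `η ∈ F`, `h(F)` closed (closed points), and `h` an isomorphism off
`h(F)`.  This file is the TOPOLOGICAL bookkeeping the count-drop brick (`ExcCount.hasSplitExcCurveCountLE_pred_of_mapsTo`,
p530074) then needs: the integral exceptional curves of `g` are exactly the `h`-images of the exceptional curves of
`ψ` outside `F`, and `h` is injective on them.

* `not_specializes_of_height_eq` — two distinct points of the same finite height do not specialise to each other;
* `Contraction.not_mem_image` — an exceptional curve `η ∉ F` is not mapped into `h(F)`;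
* `Contraction.injOn_preimage_compl` — `h` is injective off `h⁻¹(h(F))` (it is an isomorphism there);
* `Contraction.mem_excCurvePoints_apply`, `Contraction.excCurvePoints_eq_image` —
  **`excCurvePoints g = h '' (excCurvePoints ψ \ F)`** (given that points of `W` over the closed point have height
  `≤ 1`, tree `IsResolution.height_le_one_of_base_eq_closedPoint`), and `Contraction.injOn_excCurvePoints_diff`.

All hypotheses are the literal output clauses of `Lipman1969_27_1_reg_rat`; no named fact is consumed here.
References: J. Lipman, Publ. Math. IHÉS 36 (1969), Thm. (27.1) (p. 275) [`Lipman1969`]; tree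
`…NoZenoExcCurvesBaseChange` (`height_apply_le_of_isClosedMap`, res-L0-w44-stub-2).
-/

noncomputable section

-- single-problem summit: the doubled namespace component `ResolutionOfSingularities` is forced
set_option linter.dupNamespace false

namespace Summit.ResolutionOfSingularities.ResolutionOfSingularities.Theorems.NoZeno.ExcCount

open CategoryTheory AlgebraicGeometry TopologicalSpace Topology IsLocalRing
open Literature.AlgebraicGeometry.Resolution

universe u

/-! ## Points of equal finite height -/

/-- Two DISTINCT points of a scheme with the same finite `Order.height` (e.g. the generic points of two integral
exceptional curves) do not specialise to one another. [folklore] -/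
theorem not_specializes_of_height_eq {X : Scheme.{u}} {η η' : X} (hne : η ≠ η')
    (hh : Order.height η = Order.height η') (hfin : Order.height η < ⊤) : ¬ η' ⤳ η := by
  intro hsp
  have hle : η ≤ η' := (Scheme.le_iff_specializes).mpr hsp
  have hlt : η < η' := by
    refine lt_iff_le_not_ge.mpr ⟨hle, fun hge => hne ?_⟩
    exact ((Scheme.le_iff_specializes.mp hge).antisymm hsp).eq
  have := Order.height_strictMono hlt hfin
  rw [hh] at this
  exact lt_irrefl _ this

/-- A closed point has `Order.height` zero. [folklore] -/
theorem height_eq_zero_of_isClosed_singleton {X : Scheme.{u}} {y : X} (hy : IsClosed ({y} : Set X)) :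
    Order.height y = 0 := by
  rw [Order.height_eq_zero]
  intro b hb
  have hsp : y ⤳ b := (Scheme.le_iff_specializes).mp hb
  have hb' : b ∈ ({y} : Set X) := by
    rw [← hy.closure_eq]
    exact specializes_iff_mem_closure.mp hsp
  rw [Set.mem_singleton_iff.mp hb']

/-! ## The contraction dictionary -/

namespace Contraction

variable {S : Type u} [CommRing S] [IsLocalRing S] {W Y : Scheme.{u}}
  (ψ : W ⟶ Spec (.of S)) (g : Y ⟶ Spec (.of S)) (h : W ⟶ Y) (hcomp : h ≫ g = ψ)
  {F : Set W} (hF : F ⊆ excCurvePoints ψ)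
  (hfib : ∀ η ∈ F, h.base ⁻¹' {h.base η} = closure {η})
  (hC : IsClosed (h.base '' F))
  (hiso : IsIso (h ∣_ (⟨(h.base '' F)ᶜ, hC.isOpen_compl⟩ : Y.Opens)))

include hF hfib in
/-- An exceptional curve `η ∉ F` is not mapped into `h(F)`: else `η ∈ h⁻¹(h η′) = closure {η′}` for some `η′ ∈ F`,
`η′ ≠ η` of the same height `1`. [folklore] -/
theorem not_mem_image {η : W} (hη : η ∈ excCurvePoints ψ) (hηF : η ∉ F) : h.base η ∉ h.base '' F := by
  rintro ⟨η', hη'F, heq⟩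
  have hmem : η ∈ h.base ⁻¹' {h.base η'} := heq.symm
  rw [hfib η' hη'F] at hmem
  have hne : η ≠ η' := fun e => hηF (e ▸ hη'F)
  have hh : Order.height η = Order.height η' := by rw [hη.2, (hF hη'F).2]
  exact not_specializes_of_height_eq hne hh (by rw [hη.2]; exact ENat.coe_lt_top 1)
    (specializes_iff_mem_closure.mpr hmem)

include hiso in
/-- `h` is injective off `h⁻¹(h(F))` (it restricts to an isomorphism onto the complement of `h(F)`). [folklore] -/
theorem injOn_preimage_compl : Set.InjOn h.base (h.base ⁻¹' (h.base '' F)ᶜ) := by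
  intro x₁ hx₁ x₂ hx₂ heq
  set V : Y.Opens := ⟨(h.base '' F)ᶜ, hC.isOpen_compl⟩
  have hinj := (h ∣_ V).isOpenEmbedding.injective
  have h1 : (⟨x₁, hx₁⟩ : ↥(h ⁻¹ᵁ V)) = ⟨x₂, hx₂⟩ := by
    apply hinj
    apply Subtype.ext
    rw [morphismRestrict_base_coe, morphismRestrict_base_coe]
    exact heq
  exact congrArg Subtype.val h1

include hiso in
/-- Every point of `Y` off `h(F)` is the image of a point of `W` off `h⁻¹(h(F))`. [folklore] -/
theorem exists_preimage_of_not_mem {ζ : Y} (hζ : ζ ∉ h.base '' F) :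
    ∃ x : W, h.base x = ζ := by
  set V : Y.Opens := ⟨(h.base '' F)ᶜ, hC.isOpen_compl⟩
  obtain ⟨x, hx⟩ := (h ∣_ V).surjective ⟨ζ, hζ⟩
  refine ⟨x.1, ?_⟩
  have := congrArg Subtype.val hx
  rwa [morphismRestrict_base_coe] at this

include hcomp hF hfib hiso in
/-- **An exceptional curve of `ψ` outside `F` maps to an exceptional curve of `g`.**  Over the closed point by
`h ≫ g = ψ`; height `≤ 1` because `h` is a closed map; height `≥ 1` because a proper specialisation `c` of `η` has
`h c ≠ h η` (by the fibre clause if `c` lies over `h(F)`, by injectivity off it otherwise). [folklore] -/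
theorem mem_excCurvePoints_apply [UniversallyClosed h] {η : W} (hη : η ∈ excCurvePoints ψ) (hηF : η ∉ F) :
    h.base η ∈ excCurvePoints g := by
  refine ⟨?_, ?_⟩
  · -- over the closed point
    have : (h ≫ g).base η = closedPoint S := by rw [hcomp]; exact hη.1
    simpa using this
  · -- height exactly one
    refine le_antisymm ?_ ?_
    · exact (height_apply_le_of_isClosedMap h h.isClosedMap η).trans hη.2.le
    · -- a proper specialisation of `η`
      have hpos : ¬ IsMin η := by
        rw [← Order.height_ne_zero, hη.2]; exact one_ne_zero
      obtain ⟨c, hc⟩ := not_isMin_iff.mp hpos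
      have hsp : η ⤳ c := (Scheme.le_iff_specializes).mp hc.le
      have hne : c ≠ η := fun e => lt_irrefl c (e ▸ hc : c < c)
      -- `h c ≠ h η`
      have hneq : h.base c ≠ h.base η := by
        intro heq
        by_cases hcF : h.base c ∈ h.base '' F
        · obtain ⟨η', hη'F, heq'⟩ := hcF
          -- then `h η = h η'`, contradicting `not_mem_image`
          exact not_mem_image ψ h hF hfib hη hηF ⟨η', hη'F, heq'.trans heq⟩
        · have hηU : h.base η ∉ h.base '' F := not_mem_image ψ h hF hfib hη hηF
          exact hne (injOn_preimage_compl h hC hiso hcF hηU heq)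
      -- hence `h c < h η`
      have hlt : h.base c < h.base η := by
        refine lt_iff_le_not_ge.mpr ⟨(Scheme.le_iff_specializes).mpr (hsp.map h.continuous), fun hge => ?_⟩
        exact hneq (((Scheme.le_iff_specializes.mp hge).antisymm (hsp.map h.continuous)).eq)
      have hcfin : Order.height c < ⊤ :=
        lt_of_le_of_lt (Order.height_mono hc.le) (by rw [hη.2]; exact ENat.coe_lt_top 1)
      have hlt' := Order.height_strictMono hlt
        (lt_of_le_of_lt (height_apply_le_of_isClosedMap h h.isClosedMap c) hcfin)
      exact Order.one_le_iff_ne_zero.mpr (pos_of_gt hlt').ne'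

include hcomp hF hfib hiso in
/-- **`excCurvePoints g = h '' (excCurvePoints ψ \ F)`** — given that points of `W` over the closed point have height
`≤ 1` (a resolution of a two-dimensional base) and that the contracted points `h η`, `η ∈ F`, are closed.
[folklore] -/
theorem excCurvePoints_eq_image [UniversallyClosed h]
    (hht : ∀ z : W, ψ.base z = closedPoint S → Order.height z ≤ 1)
    (hc : ∀ η ∈ F, IsClosed ({h.base η} : Set Y)) :
    excCurvePoints g = h.base '' (excCurvePoints ψ \ F) := by
  ext ζ
  constructor
  · rintro ⟨hζ0, hζ1⟩
    -- `ζ` is not one of the (closed) contracted points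
    have hζF : ζ ∉ h.base '' F := by
      rintro ⟨η', hη'F, rfl⟩
      have := height_eq_zero_of_isClosed_singleton (hc η' hη'F)
      rw [this] at hζ1
      exact zero_ne_one hζ1
    obtain ⟨η, rfl⟩ := exists_preimage_of_not_mem h hC hiso hζF
    have hη0 : ψ.base η = closedPoint S := by
      rw [← hcomp]; simpa using hζ0
    have hη1 : Order.height η = 1 := by
      refine le_antisymm (hht η hη0) ?_
      rw [← hζ1]
      exact height_apply_le_of_isClosedMap h h.isClosedMap η
    have hηF : η ∉ F := fun hηF => hζF ⟨η, hηF, rfl⟩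
    exact ⟨η, ⟨⟨hη0, hη1⟩, hηF⟩, rfl⟩
  · rintro ⟨η, ⟨hη, hηF⟩, rfl⟩
    exact mem_excCurvePoints_apply ψ g h hcomp hF hfib hC hiso hη hηF

include hF hfib hiso in
/-- `h` is injective on the exceptional curves outside `F`. [folklore] -/
theorem injOn_excCurvePoints_diff : Set.InjOn h.base (excCurvePoints ψ \ F) := by
  intro η₁ h₁ η₂ h₂ heq
  exact injOn_preimage_compl h hC hiso (not_mem_image ψ h hF hfib h₁.1 h₁.2)
    (not_mem_image ψ h hF hfib h₂.1 h₂.2) heq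

end Contraction

end Summit.ResolutionOfSingularities.ResolutionOfSingularities.Theorems.NoZeno.ExcCount

end
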